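import Mathlib.Analysis.Normed.Module.FiniteDimension
import Mathlib.Topology.UniformSpace.HeineCantor
import Mathlib.Topology.OpenPartialHomeomorph.Basic
import Mathlib.Topology.Algebra.Module.Basic
import HarnessLib

/-!
# Rescalings of a composite `f' ∘ f⁻¹` of two conewise differentiable maps

Topic `Literature/Topology/FourManifolds`; input of the circle-link step of the smoothing of PD
homeomorphisms at a simplex (Munkres, Ann. of Math. 72 (1960), §4; Campbell–D'Onofrio–Vítek
(2026), Lemma 3.2).  At a vertex `b` of the PL complex the two PD charts `f` (source) and `f'`
(target) have conewise differentials `L`, `L'` — positively homogeneous homeomorphisms which are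
the UNIFORM LIMITS ON BOUNDED SETS of the rescalings `v ↦ t⁻¹ (f (b + t v) - f b)`
(Munkres (1966), Thm. 8.4; `PDDifferential.exists_homeomorph_coneDifferential`).  The map that
the sweep smooths is the composite `G = f' ∘ f⁻¹`, which is PD with respect to a CURVED complex,
so the cone-differential theorem does not apply to it directly; this file transfers the
convergence:

* `exists_bound_of_posHomogeneous` — a continuous positively homogeneous map is bounded by a
  multiple of the norm;
* `surjOn_rescale_of_close` — the key topological step: if the rescaling `φ` of the open map `f`
  at scale `t` is within `1` of `L` on the closed ball of radius `R_z` and `μ R_z ≥ 2 (R + 1)`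
  (`μ` the lower bound of `L`), then every `w` with `‖w‖ ≤ R` is `φ z` for some `‖z‖ < R_z`
  (the image of the open ball is open, contains `0`, and its frontier — inside the image of the
  sphere — stays outside the ball of radius `R`; connectedness of the segment `[0, w]`);
* `tendstoUniformlyOn_rescale_comp_symm` — consequently the rescalings of `f' ∘ f.symm` at
  `f b` converge to `L' ∘ L⁻¹` uniformly on bounded sets (with the uniform continuity of `L'` and
  `L⁻¹` on compact balls; no Lipschitz or degree arguments).

Everything is proved; no definitions; no named facts.

## References

* J. R. Munkres, *Obstructions to the smoothing of piecewise-differentiable homeomorphisms*, Ann.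
  of Math. (2) 72 (1960), 521–554, §4. [Munkres1960]
* J. R. Munkres, *Elementary differential topology* (1966), §8, Thm. 8.4. [Munkres1966]
* D. Campbell, L. D'Onofrio, T. Vítek, *Diffeomorphic approximation of piecewise affine
  homeomorphisms*, J. Geom. Anal. 36 (2026), Lemma 3.2. [CampbellDonofrioVitek2026]
-/

noncomputable section

open Set Function Metric Filter
open scoped Topology

namespace Literature.Topology.FourManifolds

variable {Q : Type*} [NormedAddCommGroup Q] [NormedSpace ℝ Q]
variable {H : Type*} [NormedAddCommGroup H] [NormedSpace ℝ H]
variable {H' : Type*} [NormedAddCommGroup H'] [NormedSpace ℝ H']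

/-! ### Positively homogeneous maps -/

/-- **A continuous positively homogeneous map is bounded by a multiple of the norm** (it is
bounded on the compact unit ball). [folklore] -/
theorem exists_bound_of_posHomogeneous [FiniteDimensional ℝ Q] {L : Q → H} (hc : Continuous L)
    (hL : ∀ (v : Q) (c : ℝ), 0 ≤ c → L (c • v) = c • L v) :
    ∃ M : ℝ, 0 < M ∧ ∀ v, ‖L v‖ ≤ M * ‖v‖ := by
  obtain ⟨M₀, hM₀⟩ := ((isCompact_closedBall (0 : Q) 1).image hc).isBounded.exists_norm_le
  refine ⟨max M₀ 1, by positivity, fun v => ?_⟩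
  by_cases hv : v = 0
  · subst hv
    have : L 0 = 0 := by simpa using hL 0 0 le_rfl
    simp [this]
  · have hn : 0 < ‖v‖ := norm_pos_iff.2 hv
    have e : L v = ‖v‖ • L (‖v‖⁻¹ • v) := by
      rw [← hL _ _ hn.le, smul_inv_smul₀ hn.ne']
    have hmem : L (‖v‖⁻¹ • v) ∈ L '' closedBall (0 : Q) 1 :=
      ⟨‖v‖⁻¹ • v, by simp [norm_smul, inv_mul_cancel₀ hn.ne'], rfl⟩
    rw [e, norm_smul, Real.norm_eq_abs, abs_of_pos hn, mul_comm]
    exact mul_le_mul_of_nonneg_right ((hM₀ _ hmem).trans (le_max_left _ _)) hn.le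

/-! ### The key step: rescalings of an open map close to `L` are onto bounded balls -/

omit [NormedSpace ℝ Q] in
/-- **Rescalings close to the conewise differential hit every bounded point.** Let
`φ : Q → H` be continuous on `B̄(0, R_z)` with `φ 0 = 0`, map the open ball `B(0, R_z)` onto an
open set, and be within `1` of `L` on `B̄(0, R_z)`, where `μ ‖v‖ ≤ ‖L v‖` and
`2 (R + 1) ≤ μ R_z`.  Then every `w` with `‖w‖ ≤ R` is `φ z` for some `‖z‖ < R_z`. [folklore] -/
theorem surjOn_rescale_of_close [ProperSpace Q] {φ L : Q → H} {R Rz μ : ℝ}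
    (hφc : ContinuousOn φ (closedBall 0 Rz))
    (hφ0 : φ 0 = 0) (hO : IsOpen (φ '' ball (0 : Q) Rz)) (hRz : 0 < Rz)
    (hclose : ∀ z ∈ closedBall (0 : Q) Rz, dist (L z) (φ z) < 1)
    (hμL : ∀ v, μ * ‖v‖ ≤ ‖L v‖) (hR : 2 * (R + 1) ≤ μ * Rz) {w : H} (hw : ‖w‖ ≤ R) :
    ∃ z ∈ ball (0 : Q) Rz, φ z = w := by
  by_contra hnot
  have hnotmem : w ∉ φ '' ball (0 : Q) Rz := fun ⟨z, hz, hzw⟩ => hnot ⟨z, hz, hzw⟩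
  have hR0 : 0 ≤ R := (norm_nonneg w).trans hw
  -- the segment from `0` to `w`
  set S : Set H := (fun s : ℝ => s • w) '' Icc 0 1 with hS_def
  have hS : IsPreconnected S :=
    isPreconnected_Icc.image _ ((continuous_id.smul continuous_const).continuousOn)
  have h0O : (0 : H) ∈ φ '' ball (0 : Q) Rz := ⟨0, mem_ball_self hRz, hφ0⟩
  have h0S : (0 : H) ∈ S := ⟨0, ⟨le_rfl, zero_le_one⟩, zero_smul _ _⟩
  have hwS : w ∈ S := ⟨1, ⟨zero_le_one, le_rfl⟩, one_smul _ _⟩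
  have hnsub : ¬ (closure (φ '' ball (0 : Q) Rz) ∩ S ⊆ φ '' ball (0 : Q) Rz) := fun h =>
    hnotmem (hS.subset_of_closure_inter_subset hO ⟨0, h0S, h0O⟩ h hwS)
  obtain ⟨w₁, ⟨hw₁cl, hw₁S⟩, hw₁not⟩ := not_subset.1 hnsub
  -- `w₁` lies in the image of the sphere
  have hcl : closure (φ '' ball (0 : Q) Rz) ⊆ φ '' closedBall (0 : Q) Rz :=
    closure_minimal (image_mono ball_subset_closedBall)
      (((ProperSpace.isCompact_closedBall 0 Rz).image_of_continuousOn hφc).isClosed) |> fun h =>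
      h
  obtain ⟨z₁, hz₁, rfl⟩ := hcl hw₁cl
  have hz₁n : ‖z₁‖ = Rz := by
    refine le_antisymm (mem_closedBall_zero_iff.1 hz₁) (not_lt.1 fun h => ?_)
    exact hw₁not ⟨z₁, mem_ball_zero_iff.2 h, rfl⟩
  -- so `‖φ z₁‖ ≥ μ R_z - 1 > R`
  have h1 : μ * Rz - 1 ≤ ‖φ z₁‖ := by
    have hd := hclose z₁ hz₁
    rw [dist_eq_norm] at hd
    have := norm_sub_norm_le (L z₁) (φ z₁)
    have hL := hμL z₁
    rw [hz₁n] at hL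
    linarith
  -- but `φ z₁ ∈ S` has norm `≤ ‖w‖ ≤ R`
  obtain ⟨s, hs, hsw⟩ := hw₁S
  have h2 : ‖φ z₁‖ ≤ R := by
    rw [← hsw, norm_smul, Real.norm_eq_abs, abs_of_nonneg hs.1]
    calc s * ‖w‖ ≤ 1 * ‖w‖ := by gcongr; exact hs.2
      _ ≤ R := by rw [one_mul]; exact hw
  linarith

/-! ### Rescalings of the composite -/

/-- The rescaling of an open partial homeomorphism at scale `t > 0` maps small open balls to
open sets. [folklore] -/
theorem isOpen_image_rescale (f : OpenPartialHomeomorph Q H) {b : Q} {t Rz : ℝ} (ht : 0 < t)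
    (hsrc : ∀ z : Q, ‖z‖ < Rz → b + t • z ∈ f.source) :
    IsOpen ((fun z : Q => t⁻¹ • (f (b + t • z) - f b)) '' ball (0 : Q) Rz) := by
  -- the affine maps as homeomorphisms
  set α : Q ≃ₜ Q := (Homeomorph.smulOfNeZero t ht.ne').trans (Homeomorph.addLeft b) with hα
  set β : H ≃ₜ H := (Homeomorph.addLeft (-f b)).trans (Homeomorph.smulOfNeZero t⁻¹ (by positivity))
    with hβ
  have hαapply : ∀ z, α z = b + t • z := fun z => rfl
  have hβapply : ∀ y, β y = t⁻¹ • (f (b + 0) - f b - (f (b + 0) - f b) + (-f b + y)) := fun y => by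
    simp [hβ]
  have heq : (fun z : Q => t⁻¹ • (f (b + t • z) - f b)) '' ball (0 : Q) Rz =
      β '' (f '' (α '' ball (0 : Q) Rz)) := by
    ext y
    simp only [mem_image, hαapply]
    constructor
    · rintro ⟨z, hz, rfl⟩
      refine ⟨f (b + t • z), ⟨b + t • z, ⟨z, hz, rfl⟩, rfl⟩, ?_⟩
      rw [hβapply]; congr 1; abel
    · rintro ⟨_, ⟨_, ⟨z, hz, rfl⟩, rfl⟩, rfl⟩
      refine ⟨z, hz, ?_⟩
      rw [hβapply]; congr 1; abel
  rw [heq]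
  refine β.isOpenMap _ (f.isOpen_image_of_subset_source (α.isOpenMap _ isOpen_ball) ?_)
  rintro _ ⟨z, hz, rfl⟩
  exact hsrc z (mem_ball_zero_iff.1 hz)

/-- **The rescalings of `f' ∘ f⁻¹` converge to `L' ∘ L⁻¹` uniformly on bounded sets.**
Let `f` be an open partial homeomorphism with `b ∈ f.source` whose rescalings at `b` converge to
the positively homogeneous homeomorphism `L` (bounded below by `μ ‖·‖`) uniformly on bounded sets,
and `f'` a map whose rescalings at `b` converge to the continuous map `L'` uniformly on bounded
sets.  Then the rescalings `w ↦ t⁻¹ (f' (f.symm (f b + t w)) - f' b)` converge to `L' ∘ L.symm`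
uniformly on bounded sets as `t → 0⁺`. [folklore] -/
theorem tendstoUniformlyOn_rescale_comp_symm [FiniteDimensional ℝ Q] [FiniteDimensional ℝ H]
    (f : OpenPartialHomeomorph Q H) {b : Q} (hb : b ∈ f.source) (f' : Q → H') (L : Q ≃ₜ H)
    (hLh : ∀ (v : Q) (c : ℝ), 0 ≤ c → L (c • v) = c • L v) {L' : Q → H'} (hL'c : Continuous L')
    {μ : ℝ} (hμ : 0 < μ) (hμL : ∀ v, μ * ‖v‖ ≤ ‖L v‖)
    (hf : ∀ R, TendstoUniformlyOn (fun (t : ℝ) (v : Q) => t⁻¹ • (f (b + t • v) - f b)) L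
      (𝓝[>] 0) (closedBall 0 R))
    (hf' : ∀ R, TendstoUniformlyOn (fun (t : ℝ) (v : Q) => t⁻¹ • (f' (b + t • v) - f' b)) L'
      (𝓝[>] 0) (closedBall 0 R)) (R : ℝ) :
    TendstoUniformlyOn (fun (t : ℝ) (w : H) => t⁻¹ • (f' (f.symm (f b + t • w)) - f' b))
      (L' ∘ L.symm) (𝓝[>] 0) (closedBall 0 R) := by
  rw [Metric.tendstoUniformlyOn_iff]
  intro ε hε
  -- radii
  set R₀ : ℝ := max R 0 with hR₀
  have hR₀0 : 0 ≤ R₀ := le_max_right _ _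
  set Rz : ℝ := 2 * (R₀ + 1) / μ with hRz
  have hRz0 : 0 < Rz := by positivity
  have hμRz : μ * Rz = 2 * (R₀ + 1) := by rw [hRz]; field_simp
  obtain ⟨M, hM, hML⟩ := exists_bound_of_posHomogeneous L.continuous hLh
  -- uniform continuity moduli of `L'` and `L.symm` on compact balls
  obtain ⟨δ₁, hδ₁, hUC'⟩ := Metric.uniformContinuousOn_iff.1
    ((ProperSpace.isCompact_closedBall (0 : Q) (Rz + 1)).uniformContinuousOn_of_continuous
      hL'c.continuousOn) (ε / 2) (by positivity)
  obtain ⟨δ₂, hδ₂, hUC⟩ := Metric.uniformContinuousOn_iff.1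
    ((ProperSpace.isCompact_closedBall (0 : H) (M * Rz + 1)).uniformContinuousOn_of_continuous
      L.symm.continuous.continuousOn) (min δ₁ 1) (by positivity)
  -- eventual conditions on the scale `t`
  obtain ⟨ρ, hρ, hρsub⟩ := Metric.isOpen_iff.1 f.open_source b hb
  have ev0 : ∀ᶠ t in 𝓝[>] (0 : ℝ), 0 < t := self_mem_nhdsWithin
  have ev1 : ∀ᶠ t in 𝓝[>] (0 : ℝ), t * (Rz + 1) < ρ := by
    have hc : Tendsto (fun t : ℝ => t * (Rz + 1)) (𝓝[>] 0) (𝓝 (0 * (Rz + 1))) :=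
      tendsto_nhdsWithin_of_tendsto_nhds ((continuous_id.mul continuous_const).tendsto 0)
    rw [zero_mul] at hc
    exact hc.eventually (gt_mem_nhds hρ)
  have ev2 : ∀ᶠ t in 𝓝[>] (0 : ℝ), ∀ z ∈ closedBall (0 : Q) Rz,
      dist (L z) (t⁻¹ • (f (b + t • z) - f b)) < min δ₂ 1 :=
    (Metric.tendstoUniformlyOn_iff.1 (hf Rz)) _ (by positivity)
  have ev3 : ∀ᶠ t in 𝓝[>] (0 : ℝ), ∀ z ∈ closedBall (0 : Q) (Rz + 1),
      dist (L' z) (t⁻¹ • (f' (b + t • z) - f' b)) < ε / 2 :=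
    (Metric.tendstoUniformlyOn_iff.1 (hf' (Rz + 1))) _ (by positivity)
  filter_upwards [ev0, ev1, ev2, ev3] with t ht0 ht1 ht2 ht3 w hw
  have hwR : ‖w‖ ≤ R₀ := (mem_closedBall_zero_iff.1 hw).trans (le_max_left _ _)
  -- points of the ball of radius `R_z + 1` are in the source at scale `t`
  have hsrc : ∀ z : Q, ‖z‖ < Rz + 1 → b + t • z ∈ f.source := fun z hz => by
    apply hρsub
    rw [mem_ball, dist_eq_norm, add_sub_cancel_left, norm_smul, Real.norm_eq_abs, abs_of_pos ht0]
    nlinarith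
  -- the rescaled map `φ`
  set φ : Q → H := fun z => t⁻¹ • (f (b + t • z) - f b) with hφ
  have hφ0 : φ 0 = 0 := by simp [hφ]
  have hφc : ContinuousOn φ (closedBall 0 Rz) := by
    refine ContinuousOn.const_smul (ContinuousOn.sub ?_ continuousOn_const) _
    refine f.continuousOn.comp (by fun_prop) fun z hz => hsrc z ?_
    linarith [mem_closedBall_zero_iff.1 hz]
  have hO : IsOpen (φ '' ball (0 : Q) Rz) :=
    isOpen_image_rescale f ht0 fun z hz => hsrc z (by linarith)
  -- the key step: `w = φ z` with `‖z‖ < R_z`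
  obtain ⟨z, hz, hzw⟩ := surjOn_rescale_of_close hφc hφ0 hO hRz0
    (fun z hz => (ht2 z hz).trans_le (min_le_right _ _)) hμL (by rw [hμRz]) hwR
  have hzn : ‖z‖ < Rz := mem_ball_zero_iff.1 hz
  -- hence `f.symm (f b + t w) = b + t z`
  have hfz : f (b + t • z) = f b + t • w := by
    have h := congrArg (fun y : H => t • y) hzw
    simp only [hφ, smul_smul, mul_inv_cancel₀ ht0.ne', one_smul] at h
    rw [← h]; abel
  have hsymm : f.symm (f b + t • w) = b + t • z := by
    rw [← hfz, f.left_inv (hsrc z (by linarith))]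
  rw [hsymm]
  -- `dist (L.symm w) z < δ₁`, both in the ball of radius `R_z + 1`
  have hLz : ‖L z‖ ≤ M * Rz := (hML z).trans (by gcongr)
  have hφz : dist (L z) (φ z) < min δ₂ 1 := ht2 z (mem_closedBall_zero_iff.2 hzn.le)
  have hw' : w = φ z := hzw.symm
  have hmem1 : L z ∈ closedBall (0 : H) (M * Rz + 1) := mem_closedBall_zero_iff.2 (by linarith)
  have hmem2 : w ∈ closedBall (0 : H) (M * Rz + 1) := by
    rw [mem_closedBall_zero_iff, hw']
    have : ‖φ z‖ ≤ ‖L z‖ + dist (L z) (φ z) := by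
      rw [dist_eq_norm, norm_sub_rev]; exact norm_le_insert' (φ z) (L z)
    linarith [hφz.trans_le (min_le_right δ₂ 1)]
  have hdz : dist (L.symm w) z < min δ₁ 1 := by
    have h := hUC (L z) hmem1 w hmem2 (by rw [hw']; exact hφz.trans_le (min_le_left _ _))
    rwa [L.symm_apply_apply, dist_comm] at h
  have hmem3 : L.symm w ∈ closedBall (0 : Q) (Rz + 1) := by
    rw [mem_closedBall_zero_iff]
    have : ‖L.symm w‖ ≤ ‖z‖ + dist (L.symm w) z := by
      rw [dist_eq_norm]; exact norm_le_insert' (L.symm w) z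
    linarith [hdz.trans_le (min_le_right δ₁ 1)]
  have hmem4 : z ∈ closedBall (0 : Q) (Rz + 1) := mem_closedBall_zero_iff.2 (by linarith)
  -- assemble
  calc dist ((L' ∘ L.symm) w) (t⁻¹ • (f' (b + t • z) - f' b))
      ≤ dist (L' (L.symm w)) (L' z) + dist (L' z) (t⁻¹ • (f' (b + t • z) - f' b)) :=
        dist_triangle _ _ _
    _ < ε / 2 + ε / 2 :=
        add_lt_add (hUC' _ hmem3 _ hmem4 (hdz.trans_le (min_le_left _ _))) (ht3 z hmem4)
    _ = ε := by ring

end Literature.Topology.FourManifolds
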